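import Summits.Ventures.PercRepro.C026PFunStar

/-!
# The star with one pendant edge deleted (p6, gen 16)

`(P)` of the `k`-star with the pendant edge `j` deleted: the vertex `j` is isolated, contributes the
factor `2 − x_j`, and the rest is the `(k − 1)`-star closed form over `ι \ {j}` (`pFun_star_erase_eq`):

`(P_{star − e_j}) = (2 − x_j)·[∏_{i ≠ j}(3 − x_i) − 2^k Z_A + 2K_A∏_{i ≠ j}(1 + n̄_iK_i) − K_AZ_A∏_{i ≠ j}(n̄_iK_i + x_i)]`.

This is the deletion minor of the star in the edge-monotonicity statement EM(corner) of mine-3 §29.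
-/

namespace PercRepro

namespace MultiGraph

open Finset

variable {ι : Type*} [Fintype ι] [DecidableEq ι]

/-- The open edges of the complement inside `univ.erase j` of a configuration with `j` closed. -/
theorem openEdges_complIn_erase (ω : Config ι) (j : ι) :
    openEdges (complIn (univ.erase j) ω) = (univ.erase j) \ openEdges ω := by
  ext i
  simp only [mem_openEdges, complIn, decide_eq_true_eq, Finset.mem_sdiff, Finset.mem_erase,
    Finset.mem_univ, and_true]
  constructor
  · rintro ⟨hi, h⟩
    exact ⟨hi, by rw [h]; exact Bool.false_ne_true⟩
  · rintro ⟨hi, h⟩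
    refine ⟨hi, ?_⟩
    cases hh : ω i
    · rfl
    · exact absurd hh h

/-- A configuration inside `univ.erase j` has `j` closed, so its open edges avoid `j`. -/
theorem openEdges_subset_erase {ω : Config ι} {j : ι} (hω : ω ∈ configsIn (univ.erase j)) :
    openEdges ω ⊆ univ.erase j := fun i hi => (mem_configsIn.1 hω) i (mem_openEdges.1 hi)

/-- The summand of the star's (P) functional on `univ.erase j`, in four-product form over `ι \ {j}`. -/
def starTermErase (x K : Option ι → ℝ) (j : ι) (S : Finset ι) : ℝ :=
  (2 - x (some j)) * (
    (∏ _i ∈ S, (1 : ℝ)) * (∏ i ∈ (univ.erase j) \ S, (2 - x (some i))) -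
      2 * x none * ((∏ i ∈ S, x (some i)) * ∏ i ∈ (univ.erase j) \ S, (2 - x (some i))) +
      2 * K none * ((∏ i ∈ S, (2 - x (some i)) * K (some i)) * ∏ _i ∈ (univ.erase j) \ S, (1 : ℝ)) -
      K none * x none * ((∏ i ∈ S, (2 - x (some i)) * K (some i)) *
        ∏ i ∈ (univ.erase j) \ S, x (some i)))

/-- The summand of the star's (P) on `univ.erase j` is `starTermErase` of the open edges. -/
theorem star_summand_erase_eq (x K : Option ι → ℝ) (j : ι) {ω : Config ι}
    (hω : ω ∈ configsIn (univ.erase j)) :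
    (star ι).nbarOff x none ω * (1 - 2 * (star ι).xCluster x none ω) +
      (star ι).kCluster K none ω * (star ι).nbar x (complIn (univ.erase j) ω) =
    starTermErase x K j (openEdges ω) := by
  unfold starTermErase
  have hsub := openEdges_subset_erase hω
  have hj : j ∉ openEdges ω := fun h => (Finset.mem_erase.1 (hsub h)).1 rfl
  -- `(openEdges ω)ᶜ = insert j ((univ.erase j) \ openEdges ω)` and
  -- `((univ.erase j) \ openEdges ω)ᶜ = insert j (openEdges ω)`
  have e1 : (openEdges ω)ᶜ = insert j ((univ.erase j) \ openEdges ω) := by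
    ext i
    simp only [Finset.mem_compl, Finset.mem_insert, Finset.mem_sdiff, Finset.mem_erase,
      Finset.mem_univ, and_true]
    constructor
    · intro h
      by_cases hij : i = j
      · exact Or.inl hij
      · exact Or.inr ⟨hij, h⟩
    · rintro (rfl | ⟨_, h⟩)
      · exact hj
      · exact h
  have e2 : ((univ.erase j) \ openEdges ω)ᶜ = insert j (openEdges ω) := by
    ext i
    simp only [Finset.mem_compl, Finset.mem_insert, Finset.mem_sdiff, Finset.mem_erase,
      Finset.mem_univ, and_true, not_and, not_not]
    constructor
    · intro h
      by_cases hij : i = j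
      · exact Or.inl hij
      · exact Or.inr (h hij)
    · rintro (rfl | h)
      · intro h'; exact absurd rfl h'
      · intro _; exact h
  have hj' : j ∉ (univ.erase j) \ openEdges ω := fun h => (Finset.mem_erase.1 (Finset.mem_sdiff.1 h).1).1 rfl
  rw [star_nbarOff, star_xCluster, star_kCluster, star_nbar, openEdges_complIn_erase ω j, e1, e2,
    Finset.prod_insert hj', Finset.prod_insert hj, Finset.prod_mul_distrib, Finset.prod_const_one,
    Finset.prod_const_one]
  ring

/-- Sums over the configurations inside `univ.erase j` are sums over the subsets of `univ.erase j`. -/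
theorem sum_configsIn_erase_eq_sum_powerset (j : ι) (f : Finset ι → ℝ) :
    ∑ ω ∈ configsIn (univ.erase j), f (openEdges ω) = ∑ S ∈ (univ.erase j).powerset, f S := by
  refine Finset.sum_nbij' openEdges (fun S i => decide (i ∈ S)) ?_ ?_ ?_ ?_ (fun _ _ => rfl)
  · intro ω hω
    exact Finset.mem_powerset.2 (openEdges_subset_erase hω)
  · intro S hS
    rw [mem_configsIn]
    intro i hi
    simp only [decide_eq_true_eq] at hi
    exact Finset.mem_powerset.1 hS hi
  · intro ω _
    funext i
    simp [mem_openEdges]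
  · intro S _
    ext i
    simp [mem_openEdges]

/-- **The star with the pendant edge `j` deleted**: `(P) = (2 − x_j)·[the (k − 1)-star closed form
over `ι \ {j}`]`. -/
theorem pFun_star_erase_eq (x K : Option ι → ℝ) (j : ι) :
    (star ι).pFun none x K (univ.erase j) =
      (2 - x (some j)) * ((∏ i ∈ univ.erase j, (3 - x (some i))) -
        2 ^ (Fintype.card ι - 1 + 1) * x none +
        2 * K none * ∏ i ∈ univ.erase j, (1 + (2 - x (some i)) * K (some i)) -
        K none * x none * ∏ i ∈ univ.erase j, ((2 - x (some i)) * K (some i) + x (some i))) := by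
  unfold pFun
  rw [Finset.sum_congr rfl fun ω hω => star_summand_erase_eq x K j hω,
    sum_configsIn_erase_eq_sum_powerset j (starTermErase x K j)]
  unfold starTermErase
  simp only [← Finset.mul_sum, Finset.sum_add_distrib, Finset.sum_sub_distrib]
  have h1 : ∑ S ∈ (univ.erase j).powerset, (∏ _i ∈ S, (1 : ℝ)) * ∏ i ∈ (univ.erase j) \ S, (2 - x (some i)) =
      ∏ i ∈ univ.erase j, (3 - x (some i)) := by
    rw [← Finset.prod_add]
    exact Finset.prod_congr rfl fun i _ => by ring
  have h2 : ∑ S ∈ (univ.erase j).powerset, (∏ i ∈ S, x (some i)) * ∏ i ∈ (univ.erase j) \ S, (2 - x (some i)) =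
      2 ^ (Fintype.card ι - 1) := by
    rw [← Finset.prod_add]
    simp only [add_sub_cancel, Finset.prod_const, Finset.card_erase_of_mem (Finset.mem_univ j),
      Finset.card_univ]
  have h3 : ∑ S ∈ (univ.erase j).powerset, (∏ i ∈ S, (2 - x (some i)) * K (some i)) * ∏ _i ∈ (univ.erase j) \ S, (1 : ℝ) =
      ∏ i ∈ univ.erase j, (1 + (2 - x (some i)) * K (some i)) := by
    rw [← Finset.prod_add]
    exact Finset.prod_congr rfl fun i _ => by ring
  have h4 : ∑ S ∈ (univ.erase j).powerset, (∏ i ∈ S, (2 - x (some i)) * K (some i)) * ∏ i ∈ (univ.erase j) \ S, x (some i) =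
      ∏ i ∈ univ.erase j, ((2 - x (some i)) * K (some i) + x (some i)) := by
    rw [← Finset.prod_add]
  rw [h1, h2, h3, h4]
  ring

end MultiGraph

end PercRepro
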